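import Summits.KontsevichZagierPeriods.KontsevichZagierPeriods.Theorems.IsogenyCertificatesJLPairIdentityOneTwoSheetTransport
import Summits.KontsevichZagierPeriods.KontsevichZagierPeriods.Theorems.IsogenyCertificatesXMapPeriodTransferCellsBasic
import Summits.KontsevichZagierPeriods.KontsevichZagierPeriods.Theorems.TerasomaMultiplicationReflectionThirdMoves
import Literature.NumberTheory.Transcendental.KZCalculus
import Literature.NumberTheory.Transcendental.SemialgebraicLineDeriv

/-!
# `BiellipticRealPeriodCell` (stmt-KontsevichZagierPeriods-18685), line `Sketch`, stub F

Registered stub `stub_halfMoves`: the two rule-(2) moves of the Kontsevich–Zagier calculus on a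
sign-half of the bielliptic sector. `F = G(X²) ∈ ℚ[X]`, `(α, β)` a ONE-SIGNED interval (`0 ≤ α`
or `β ≤ 0`) on which `F > 0` and `dx/√F` converges, `P(t) = t³ + At + B` an integral short
Weierstrass cubic.

* **odd part** `a₁y dy/√F`, along `φ₁(y) = (y² − s)/m`: the model identity
  `m³F(y) = k²((y² − s)³ + Am²(y² − s) + Bm³)` says `F = k²·P(φ₁)`, so `√F = |k|√P(φ₁)`,
  `φ₁' = 2y/m`, and `a₁y/√F = (σa₁|m|/2|k|)·(1/√P(φ₁))·|φ₁'|` with `σ = ±1` the sign of the half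
  (`odd_model`, `odd_jacobian`);
* **even part** `a₀ dy/√F`, along `φ₂(y) = (y⁻² − s)/m`: the model identity
  `m³F(y) = k²((1 − sy²)³ + Am²y⁴(1 − sy²) + Bm³y⁶)` says `F = k²y⁶·P(φ₂)` (`y ≠ 0`), so
  `√F = |k||y|³√P(φ₂)`, `φ₂' = −2/(my³)`, and `a₀/√F = (a₀|m|/2|k|)·(1/√P(φ₂))·|φ₂'|`
  (`even_model`, `even_jacobian`).

Both maps are rational with rational coefficients, injective with nowhere-zero derivative on a
one-signed interval, so each move is ONE instance of the landed one-sheet transport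
`TwoSheetTransport.oneSheet` (rule 2): the source representations `O = [(α,β), a₁y/√F]`,
`E = [(α,β), a₀/√F]` are constructed here (semialgebraic integrands: const · coordinate / √poly;
integrability from that of `1/√F` times a bounded continuous factor), the targets live on the
images `φᵢ((α,β))` with integrands `c/√P` (helpers on `ℝ¹` reused from `ReflectionThird`). The
interval `(α, β)` enters a `KZ.IntegralRep 1` as its domain, so it must be `ℚ`-semialgebraic in
`ℝ¹`; this is the hypothesis `IsSemialgebraic ℚ {x | x 0 ∈ Ioo α β}` of `stub_halfMoves` (for
arbitrary real `α < β` inside a positivity component of `F` it fails, e.g. `β = π`). No definitions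
are introduced.

References: M. Kontsevich, D. Zagier, *Periods* (2001), §1.2 rule (2); J. Bochnak, M. Coste,
M.-F. Roy, *Real Algebraic Geometry* (1998), §2.2.
-/

noncomputable section

open Polynomial Set MeasureTheory
open Literature.NumberTheory.Transcendental
open Literature.ModelTheory.ExponentialFields (IsSemialgebraic)
open Summit.KontsevichZagierPeriods.KontsevichZagierPeriods.Theorems.ReflectionThird
  (eq_of_apply_zero_eq isSemialgebraicFunOn_coord)

namespace Summit.KontsevichZagierPeriods.IsogenyCertificates.BiellipticRealPeriodCellStubs.HalfMoves

/-! ### Real-number identities: models, Jacobians, derivatives -/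

/-- The odd model identity divided by `m³`: `F = k²·P((y² − s)/m)`. [folklore] -/
theorem odd_model {F m k s A B y : ℝ} (hm : m ≠ 0)
    (h : m ^ 3 * F = k ^ 2 * ((y ^ 2 - s) ^ 3 + A * m ^ 2 * (y ^ 2 - s) + B * m ^ 3)) :
    F = k ^ 2 * (((y ^ 2 - s) / m) ^ 3 + A * ((y ^ 2 - s) / m) + B) := by
  have key : m ^ 3 * (((y ^ 2 - s) / m) ^ 3 + A * ((y ^ 2 - s) / m) + B) =
      (y ^ 2 - s) ^ 3 + A * m ^ 2 * (y ^ 2 - s) + B * m ^ 3 := by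
    field_simp
  refine mul_left_cancel₀ (pow_ne_zero 3 hm) ?_
  rw [h, ← key]
  ring

/-- The even model identity divided by `m³` at `y ≠ 0`: `F = k²y⁶·P((y⁻² − s)/m)`. [folklore] -/
theorem even_model {F m k s A B y : ℝ} (hm : m ≠ 0) (hy : y ≠ 0)
    (h : m ^ 3 * F = k ^ 2 * ((1 - s * y ^ 2) ^ 3 + A * m ^ 2 * y ^ 4 * (1 - s * y ^ 2) +
      B * m ^ 3 * y ^ 6)) :
    F = k ^ 2 * y ^ 6 * ((((y ^ 2)⁻¹ - s) / m) ^ 3 + A * (((y ^ 2)⁻¹ - s) / m) + B) := by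
  have key : m ^ 3 * (y ^ 6 * ((((y ^ 2)⁻¹ - s) / m) ^ 3 + A * (((y ^ 2)⁻¹ - s) / m) + B)) =
      (1 - s * y ^ 2) ^ 3 + A * m ^ 2 * y ^ 4 * (1 - s * y ^ 2) + B * m ^ 3 * y ^ 6 := by
    field_simp
  refine mul_left_cancel₀ (pow_ne_zero 3 hm) ?_
  rw [h, ← key]
  ring

/-- The odd Jacobian identity: if `f = k²P` with `P > 0` and `σ|y| = y`, then
`a y/√f = (σa|m|/2|k|)·(1/√P)·|2y/m|`. [cite: KontsevichZagier2001, §1.2 rule (2)] -/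
theorem odd_jacobian {f P k m y : ℝ} (a σ : ℝ) (hP : 0 < P) (hk : k ≠ 0) (hm : m ≠ 0)
    (hf : f = k ^ 2 * P) (hσy : σ * |y| = y) :
    a * y / Real.sqrt f = σ * a * |m| / (2 * |k|) * (1 / Real.sqrt P) * |2 * y / m| := by
  have hsP : 0 < Real.sqrt P := Real.sqrt_pos.2 hP
  have hk' : 0 < |k| := abs_pos.2 hk
  have hm' : 0 < |m| := abs_pos.2 hm
  rw [hf, Real.sqrt_mul' _ hP.le, Real.sqrt_sq_eq_abs, abs_div, abs_mul, abs_two,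
    show a * y = a * (σ * |y|) by rw [hσy]]
  field_simp

/-- The even Jacobian identity: if `f = k²y⁶P` with `P > 0`, `y ≠ 0`, then
`a/√f = (a|m|/2|k|)·(1/√P)·|−2/(my³)|`. [cite: KontsevichZagier2001, §1.2 rule (2)] -/
theorem even_jacobian {f P k m y : ℝ} (a : ℝ) (hP : 0 < P) (hk : k ≠ 0) (hm : m ≠ 0)
    (hy : y ≠ 0) (hf : f = k ^ 2 * y ^ 6 * P) :
    a / Real.sqrt f = a * |m| / (2 * |k|) * (1 / Real.sqrt P) * |-2 / (m * y ^ 3)| := by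
  have hsP : 0 < Real.sqrt P := Real.sqrt_pos.2 hP
  have hk' : 0 < |k| := abs_pos.2 hk
  have hm' : 0 < |m| := abs_pos.2 hm
  have hy' : 0 < |y| := abs_pos.2 hy
  have h1 : k ^ 2 * y ^ 6 * P = (k * y ^ 3) ^ 2 * P := by ring
  rw [hf, h1, Real.sqrt_mul' _ hP.le, Real.sqrt_sq_eq_abs, abs_mul, abs_pow, abs_div, abs_neg,
    abs_mul, abs_pow, abs_two]
  field_simp

/-- `φ₁(y) = (y² − s)/m` has derivative `2y/m`. [folklore] -/
theorem hasDerivAt_phi1 (s m y : ℝ) :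
    HasDerivAt (fun y : ℝ => (y ^ 2 - s) / m) (2 * y / m) y := by
  refine (((hasDerivAt_pow 2 y).sub_const s).div_const m).congr_deriv ?_
  norm_num

/-- `φ₂(y) = (y⁻² − s)/m` has derivative `−2/(my³)` at `y ≠ 0`. [folklore] -/
theorem hasDerivAt_phi2 (s m : ℝ) {y : ℝ} (hy : y ≠ 0) :
    HasDerivAt (fun y : ℝ => ((y ^ 2)⁻¹ - s) / m) (-2 / (m * y ^ 3)) y := by
  by_cases hm : m = 0
  · subst hm
    simp only [div_zero, zero_mul]
    exact hasDerivAt_const y 0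
  refine ((((hasDerivAt_pow 2 y).inv (pow_ne_zero 2 hy)).sub_const s).div_const m).congr_deriv ?_
  field_simp
  ring

/-! ### Small geometric helpers on `ℝ¹ = Fin 1 → ℝ` and on one-signed intervals -/

/-- The map `p ↦ (φ (p 0))` of `ℝ¹` carries `{x | x 0 ∈ S}` onto `{x | x 0 ∈ φ '' S}`. [folklore] -/
theorem image_hat (φ : ℝ → ℝ) (S : Set ℝ) :
    (fun p : Fin 1 → ℝ => fun _ : Fin 1 => φ (p 0)) '' {x : Fin 1 → ℝ | x 0 ∈ S} =
      {x : Fin 1 → ℝ | x 0 ∈ φ '' S} := by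
  ext x
  simp only [mem_image, mem_setOf_eq]
  constructor
  · rintro ⟨p, hp, rfl⟩
    exact ⟨p 0, hp, rfl⟩
  · rintro ⟨y, hy, hyx⟩
    exact ⟨fun _ => y, hy, eq_of_apply_zero_eq hyx⟩

/-- Points of a one-signed open interval are nonzero. [folklore] -/
theorem ne_zero_of_mem_Ioo {α β y : ℝ} (h : 0 ≤ α ∨ β ≤ 0) (hy : y ∈ Ioo α β) : y ≠ 0 := by
  rcases h with h | h
  · exact (h.trans_lt hy.1).ne'
  · exact (hy.2.trans_le h).ne

/-- `y ↦ y²` is injective on a one-signed interval. [folklore] -/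
theorem eq_of_sq_eq_of_mem_Ioo {α β y y' : ℝ} (h : 0 ≤ α ∨ β ≤ 0) (hy : y ∈ Ioo α β)
    (hy' : y' ∈ Ioo α β) (he : y ^ 2 = y' ^ 2) : y = y' := by
  rcases h with h | h
  · exact (sq_eq_sq₀ (h.trans_lt hy.1).le (h.trans_lt hy'.1).le).1 he
  · have h1 : -y = -y' :=
      (sq_eq_sq₀ (neg_nonneg.2 (hy.2.trans_le h).le) (neg_nonneg.2 (hy'.2.trans_le h).le)).1
        (by rw [neg_sq, neg_sq, he])
    exact neg_injective h1

/-! ### Semialgebraic atoms on a `ℚ`-semialgebraic `W ⊆ ℝ¹` -/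

/-- A rational one-variable polynomial read in the coordinate `x 0` is `ℚ`-semialgebraic on `W`.
[cite: BochnakCosteRoy1998, §2.2] -/
theorem sa_aeval {W : Set (Fin 1 → ℝ)} (hW : IsSemialgebraic ℚ W) (F : ℚ[X]) :
    IsSemialgebraicFunOn ℚ W (fun x => aeval (x 0) F) :=
  (isSemialgebraicFunOn_aeval hW (aeval (MvPolynomial.X 0 : MvPolynomial (Fin 1) ℚ) F)).congr
    fun x _ => XMapPeriodTransferCells.aeval_aeval_X_zero F x

/-- Quotients of real `ℚ`-semialgebraic functions are semialgebraic (Mathlib's junk value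
`x / 0 = 0` included). [cite: BochnakCosteRoy1998, Prop. 2.2.6] -/
theorem sa_div {W : Set (Fin 1 → ℝ)} {f g : (Fin 1 → ℝ) → ℝ} (hf : IsSemialgebraicFunOn ℚ W f)
    (hg : IsSemialgebraicFunOn ℚ W g) : IsSemialgebraicFunOn ℚ W (fun x => f x / g x) :=
  (hf.fun_mul hg.fun_inv).congr fun x _ => (div_eq_mul_inv (f x) (g x)).symm

/-! ### The odd move -/

/-- **Odd half move.** On a one-signed `ℚ`-semialgebraic interval `(α, β)` on which
`F = G(X²) > 0` and `dx/√F` converges, the representation `O = [(α,β), a₁y/√F]` exists and ONE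
change of variables along `φ₁(y) = (y² − s)/m` (rule 2, `TwoSheetTransport.oneSheet`) turns it into
a representation on `φ₁((α,β))` with integrand `(σa₁|m|/2|k|)/√(t³ + At + B)`, `σ` the sign of the
half. [cite: KontsevichZagier2001, §1.2 rule (2)] -/
theorem halfMove_odd : ∀ (G : ℚ[X]) (m s k : ℚ) (A B : ℤ) (a₁ σ : ℚ) (α β : ℝ), m ≠ 0 → k ≠ 0 →
    (∀ y : ℝ, (m : ℝ) ^ 3 * aeval y (G.comp (X ^ 2)) =
      (k : ℝ) ^ 2 * ((y ^ 2 - s) ^ 3 + (A : ℝ) * m ^ 2 * (y ^ 2 - s) + (B : ℝ) * m ^ 3)) →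
    α < β → IsSemialgebraic ℚ {x : Fin 1 → ℝ | x 0 ∈ Ioo α β} →
    ((0 ≤ α ∧ σ = 1) ∨ (β ≤ 0 ∧ σ = -1)) →
    (∀ y ∈ Ioo α β, 0 < aeval y (G.comp (X ^ 2))) →
    IntegrableOn (fun x : Fin 1 → ℝ => 1 / Real.sqrt (aeval (x 0) (G.comp (X ^ 2))))
      {x | x 0 ∈ Ioo α β} →
    ∃ O t : KZ.IntegralRep 1,
      O.domain = {x | x 0 ∈ Ioo α β} ∧
      O.integrand = (fun x => (a₁ : ℝ) * x 0 / Real.sqrt (aeval (x 0) (G.comp (X ^ 2)))) ∧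
      t.domain = {x | x 0 ∈ (fun y : ℝ => (y ^ 2 - s) / m) '' Ioo α β} ∧
      EqOn t.integrand (fun x => ((σ * a₁ * |m| / (2 * |k|) : ℚ) : ℝ) /
        Real.sqrt (x 0 ^ 3 + (A : ℝ) * x 0 + (B : ℝ))) t.domain ∧
      KZ.of O - KZ.of t ∈ KZ.relations := by
  intro G m s k A B a₁ σ α β hm hk hmodel _hαβ hsa hσ hpos hint
  have hsign : 0 ≤ α ∨ β ≤ 0 := hσ.imp (fun h => h.1) (fun h => h.1)
  have hm' : (m : ℝ) ≠ 0 := by exact_mod_cast hm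
  have hk' : (k : ℝ) ≠ 0 := by exact_mod_cast hk
  have hy0 : ∀ p ∈ {x : Fin 1 → ℝ | x 0 ∈ Ioo α β}, p 0 ≠ 0 := fun p hp =>
    ne_zero_of_mem_Ioo hsign hp
  have hWm : MeasurableSet {x : Fin 1 → ℝ | x 0 ∈ Ioo α β} :=
    measurable_pi_apply 0 measurableSet_Ioo
  -- the source representation `O`
  have hcoord := isSemialgebraicFunOn_coord hsa
  have hsaO : IsSemialgebraicFunOn ℚ {x : Fin 1 → ℝ | x 0 ∈ Ioo α β}
      (fun x => (a₁ : ℝ) * x 0 / Real.sqrt (aeval (x 0) (G.comp (X ^ 2)))) :=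
    sa_div ((isSemialgebraicFunOn_const_ratCast hsa a₁).fun_mul hcoord)
      (sa_aeval hsa (G.comp (X ^ 2))).fun_sqrt
  have hintO : IntegrableOn (fun x => (a₁ : ℝ) * x 0 / Real.sqrt (aeval (x 0) (G.comp (X ^ 2))))
      {x : Fin 1 → ℝ | x 0 ∈ Ioo α β} := by
    have hK : IsCompact (Icc (fun _ : Fin 1 => α) (fun _ => β)) := isCompact_Icc
    have hWK : {x : Fin 1 → ℝ | x 0 ∈ Ioo α β} ⊆ Icc (fun _ : Fin 1 => α) (fun _ => β) :=
      fun p hp => ⟨fun i => by rw [Subsingleton.elim i 0]; exact hp.1.le,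
        fun i => by rw [Subsingleton.elim i 0]; exact hp.2.le⟩
    have hg : ContinuousOn (fun x : Fin 1 → ℝ => (a₁ : ℝ) * x 0)
        (Icc (fun _ : Fin 1 => α) (fun _ => β)) :=
      (continuous_const.mul (continuous_apply 0)).continuousOn
    exact IntegrableOn.congr_fun (IntegrableOn.continuousOn_mul_of_subset hg hint hK hWm hWK)
      (fun x _ => mul_one_div _ _) hWm
  let O : KZ.IntegralRep 1 := ⟨{x : Fin 1 → ℝ | x 0 ∈ Ioo α β},
    fun x => (a₁ : ℝ) * x 0 / Real.sqrt (aeval (x 0) (G.comp (X ^ 2))), hsa, hsaO, hintO⟩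
  -- hypotheses of the one-sheet transport along `φ₁(y) = (y² - s)/m`, `φ₁' = 2y/m`
  have hφ : IsSemialgebraicFunOn ℚ O.domain (fun p => (p 0 ^ 2 - (s : ℝ)) / (m : ℝ)) :=
    sa_div ((hcoord.fun_pow 2).fun_sub (isSemialgebraicFunOn_const_ratCast hsa s))
      (isSemialgebraicFunOn_const_ratCast hsa m)
  have hφ' : IsSemialgebraicFunOn ℚ O.domain (fun p => 2 * p 0 / (m : ℝ)) :=
    sa_div ((isSemialgebraicFunOn_const_ofNat hsa 2).fun_mul hcoord)
      (isSemialgebraicFunOn_const_ratCast hsa m)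
  have hr : ∀ p ∈ O.domain, O.integrand p = ((σ * a₁ * |m| / (2 * |k|) : ℚ) : ℝ) *
      (1 / Real.sqrt (((p 0 ^ 2 - (s : ℝ)) / m) ^ 3 + (A : ℝ) * ((p 0 ^ 2 - (s : ℝ)) / m) +
        (B : ℝ))) * |2 * p 0 / (m : ℝ)| := by
    intro p hp
    have hy : p 0 ∈ Ioo α β := hp
    have hfeq := odd_model (A := (A : ℝ)) (B := (B : ℝ)) hm' (hmodel (p 0))
    have hP :
        0 < ((p 0 ^ 2 - (s : ℝ)) / m) ^ 3 + (A : ℝ) * ((p 0 ^ 2 - (s : ℝ)) / m) + (B : ℝ) := by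
      have h := hpos (p 0) hy
      rw [hfeq] at h
      exact pos_of_mul_pos_right h (sq_nonneg _)
    have hσy : (σ : ℝ) * |p 0| = p 0 := by
      rcases hσ with ⟨hα, rfl⟩ | ⟨hβ, rfl⟩
      · rw [abs_of_pos (hα.trans_lt hy.1)]; simp
      · rw [abs_of_neg (hy.2.trans_le hβ)]; simp
    show (a₁ : ℝ) * p 0 / Real.sqrt (aeval (p 0) (G.comp (X ^ 2))) = _
    rw [show ((σ * a₁ * |m| / (2 * |k|) : ℚ) : ℝ) = (σ : ℝ) * a₁ * |(m : ℝ)| / (2 * |(k : ℝ)|) by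
      norm_cast]
    exact odd_jacobian (a₁ : ℝ) (σ : ℝ) hP hk' hm' hfeq hσy
  obtain ⟨t, htd, hti, hrel⟩ := TwoSheetTransport.oneSheet O
    (fun u => 1 / Real.sqrt (u ^ 3 + (A : ℝ) * u + (B : ℝ)))
    (fun y : ℝ => (y ^ 2 - s) / m) (fun y : ℝ => 2 * y / m) (σ * a₁ * |m| / (2 * |k|))
    hφ hφ' (fun p _ => hasDerivAt_phi1 _ _ _)
    (fun p hp => div_ne_zero (mul_ne_zero two_ne_zero (hy0 p hp)) hm')
    (fun p hp q hq h => eq_of_apply_zero_eq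
      (eq_of_sq_eq_of_mem_Ioo hsign hp hq (sub_left_inj.1 ((div_left_inj' hm').1 h))))
    hr
  refine ⟨O, t, rfl, rfl, ?_, ?_, KZ.changeOfVariablesRel_subset_relations hrel⟩
  · rw [htd]
    exact image_hat (fun y : ℝ => (y ^ 2 - s) / m) (Ioo α β)
  · intro x hx
    rw [htd] at hx
    obtain ⟨p, hp, rfl⟩ := hx
    rw [hti p hp]
    exact mul_one_div _ _

/-! ### The even move -/

/-- **Even half move.** On a one-signed `ℚ`-semialgebraic interval `(α, β)` on which
`F = G(X²) > 0` and `dx/√F` converges, the representation `E = [(α,β), a₀/√F]` exists and ONE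
change of variables along `φ₂(y) = (y⁻² − s)/m` (rule 2, `TwoSheetTransport.oneSheet`) turns it into
a representation on `φ₂((α,β))` with integrand `(a₀|m|/2|k|)/√(t³ + At + B)`.
[cite: KontsevichZagier2001, §1.2 rule (2)] -/
theorem halfMove_even : ∀ (G : ℚ[X]) (m s k : ℚ) (A B : ℤ) (a₀ : ℚ) (α β : ℝ), m ≠ 0 → k ≠ 0 →
    (∀ y : ℝ, (m : ℝ) ^ 3 * aeval y (G.comp (X ^ 2)) =
      (k : ℝ) ^ 2 * ((1 - s * y ^ 2) ^ 3 + (A : ℝ) * m ^ 2 * y ^ 4 * (1 - s * y ^ 2) +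
        (B : ℝ) * m ^ 3 * y ^ 6)) →
    α < β → IsSemialgebraic ℚ {x : Fin 1 → ℝ | x 0 ∈ Ioo α β} → (0 ≤ α ∨ β ≤ 0) →
    (∀ y ∈ Ioo α β, 0 < aeval y (G.comp (X ^ 2))) →
    IntegrableOn (fun x : Fin 1 → ℝ => 1 / Real.sqrt (aeval (x 0) (G.comp (X ^ 2))))
      {x | x 0 ∈ Ioo α β} →
    ∃ E t : KZ.IntegralRep 1,
      E.domain = {x | x 0 ∈ Ioo α β} ∧
      E.integrand = (fun x => (a₀ : ℝ) / Real.sqrt (aeval (x 0) (G.comp (X ^ 2)))) ∧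
      t.domain = {x | x 0 ∈ (fun y : ℝ => ((y ^ 2)⁻¹ - s) / m) '' Ioo α β} ∧
      EqOn t.integrand (fun x => ((a₀ * |m| / (2 * |k|) : ℚ) : ℝ) /
        Real.sqrt (x 0 ^ 3 + (A : ℝ) * x 0 + (B : ℝ))) t.domain ∧
      KZ.of E - KZ.of t ∈ KZ.relations := by
  intro G m s k A B a₀ α β hm hk hmodel _hαβ hsa hsign hpos hint
  have hm' : (m : ℝ) ≠ 0 := by exact_mod_cast hm
  have hk' : (k : ℝ) ≠ 0 := by exact_mod_cast hk
  have hy0 : ∀ p ∈ {x : Fin 1 → ℝ | x 0 ∈ Ioo α β}, p 0 ≠ 0 := fun p hp =>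
    ne_zero_of_mem_Ioo hsign hp
  have hWm : MeasurableSet {x : Fin 1 → ℝ | x 0 ∈ Ioo α β} :=
    measurable_pi_apply 0 measurableSet_Ioo
  -- the source representation `E`
  have hcoord := isSemialgebraicFunOn_coord hsa
  have hsaE : IsSemialgebraicFunOn ℚ {x : Fin 1 → ℝ | x 0 ∈ Ioo α β}
      (fun x => (a₀ : ℝ) / Real.sqrt (aeval (x 0) (G.comp (X ^ 2)))) :=
    sa_div (isSemialgebraicFunOn_const_ratCast hsa a₀) (sa_aeval hsa (G.comp (X ^ 2))).fun_sqrt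
  have hintE : IntegrableOn (fun x => (a₀ : ℝ) / Real.sqrt (aeval (x 0) (G.comp (X ^ 2))))
      {x : Fin 1 → ℝ | x 0 ∈ Ioo α β} :=
    IntegrableOn.congr_fun (hint.const_mul (a₀ : ℝ)) (fun x _ => mul_one_div _ _) hWm
  let E : KZ.IntegralRep 1 := ⟨{x : Fin 1 → ℝ | x 0 ∈ Ioo α β},
    fun x => (a₀ : ℝ) / Real.sqrt (aeval (x 0) (G.comp (X ^ 2))), hsa, hsaE, hintE⟩
  -- hypotheses of the one-sheet transport along `φ₂(y) = (y⁻² - s)/m`, `φ₂' = -2/(m y³)`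
  have hφ : IsSemialgebraicFunOn ℚ E.domain (fun p => ((p 0 ^ 2)⁻¹ - (s : ℝ)) / (m : ℝ)) :=
    sa_div ((hcoord.fun_pow 2).fun_inv.fun_sub (isSemialgebraicFunOn_const_ratCast hsa s))
      (isSemialgebraicFunOn_const_ratCast hsa m)
  have hφ' : IsSemialgebraicFunOn ℚ E.domain (fun p => -2 / ((m : ℝ) * p 0 ^ 3)) :=
    sa_div (isSemialgebraicFunOn_const_ofNat hsa 2).fun_neg
      ((isSemialgebraicFunOn_const_ratCast hsa m).fun_mul (hcoord.fun_pow 3))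
  have hr : ∀ p ∈ E.domain, E.integrand p = ((a₀ * |m| / (2 * |k|) : ℚ) : ℝ) *
      (1 / Real.sqrt ((((p 0 ^ 2)⁻¹ - (s : ℝ)) / m) ^ 3 + (A : ℝ) * (((p 0 ^ 2)⁻¹ - (s : ℝ)) / m) +
        (B : ℝ))) * |-2 / ((m : ℝ) * p 0 ^ 3)| := by
    intro p hp
    have hy : p 0 ∈ Ioo α β := hp
    have hfeq := even_model (A := (A : ℝ)) (B := (B : ℝ)) hm' (hy0 p hp) (hmodel (p 0))
    have hP : 0 < (((p 0 ^ 2)⁻¹ - (s : ℝ)) / m) ^ 3 + (A : ℝ) * (((p 0 ^ 2)⁻¹ - (s : ℝ)) / m) +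
        (B : ℝ) := by
      have h := hpos (p 0) hy
      rw [hfeq] at h
      exact pos_of_mul_pos_right h (mul_nonneg (sq_nonneg _) (by positivity))
    show (a₀ : ℝ) / Real.sqrt (aeval (p 0) (G.comp (X ^ 2))) = _
    rw [show ((a₀ * |m| / (2 * |k|) : ℚ) : ℝ) = (a₀ : ℝ) * |(m : ℝ)| / (2 * |(k : ℝ)|) by
      norm_cast]
    exact even_jacobian (a₀ : ℝ) hP hk' hm' (hy0 p hp) hfeq
  obtain ⟨t, htd, hti, hrel⟩ := TwoSheetTransport.oneSheet E
    (fun u => 1 / Real.sqrt (u ^ 3 + (A : ℝ) * u + (B : ℝ)))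
    (fun y : ℝ => ((y ^ 2)⁻¹ - s) / m) (fun y : ℝ => -2 / (m * y ^ 3)) (a₀ * |m| / (2 * |k|))
    hφ hφ' (fun p hp => hasDerivAt_phi2 _ _ (hy0 p hp))
    (fun p hp => div_ne_zero (by norm_num) (mul_ne_zero hm' (pow_ne_zero 3 (hy0 p hp))))
    (fun p hp q hq h => eq_of_apply_zero_eq (eq_of_sq_eq_of_mem_Ioo hsign hp hq
      (inv_inj.1 (sub_left_inj.1 ((div_left_inj' hm').1 h)))))
    hr
  refine ⟨E, t, rfl, rfl, ?_, ?_, KZ.changeOfVariablesRel_subset_relations hrel⟩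
  · rw [htd]
    exact image_hat (fun y : ℝ => ((y ^ 2)⁻¹ - s) / m) (Ioo α β)
  · intro x hx
    rw [htd] at hx
    obtain ⟨p, hp, rfl⟩ := hx
    rw [hti p hp]
    exact mul_one_div _ _

/-! ### The stub -/

/-- **Registered stub `stub_halfMoves` (F) — the two rule-(2) moves on a sign-half.** On a
one-signed `ℚ`-semialgebraic interval `(α, β)` on which `F = G(X²) > 0` and `dx/√F` converges:
(odd) along `φ₁(y) = (y² − s)/m` the representation `[(α,β), a₁y/√F]` exists and differs by a
relation from a representation on `φ₁((α,β))` with integrand `(σa₁|m|/2|k|)/√(t³ + At + B)`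
(`σ = ±1` the sign of the half); (even) along `φ₂(y) = (y⁻² − s)/m` the representation
`[(α,β), a₀/√F]` exists and differs by a relation from a representation on `φ₂((α,β))` with
integrand `(a₀|m|/2|k|)/√(t³ + At + B)`. CORRECTED SIGNATURE: the hypothesis
`IsSemialgebraic ℚ {x : Fin 1 → ℝ | x 0 ∈ Ioo α β}` is inserted after `α < β` in both conjuncts
(the source representation has this set as its domain, so it is necessary; it fails for general
real end points, e.g. `β = π`). [cite: KontsevichZagier2001, §1.2 rule (2)] -/
theorem stub_halfMoves :
    (∀ (G : ℚ[X]) (m s k : ℚ) (A B : ℤ) (a₁ σ : ℚ) (α β : ℝ), m ≠ 0 → k ≠ 0 →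
      (∀ y : ℝ, (m : ℝ) ^ 3 * aeval y (G.comp (X ^ 2)) =
        (k : ℝ) ^ 2 * ((y ^ 2 - s) ^ 3 + (A : ℝ) * m ^ 2 * (y ^ 2 - s) + (B : ℝ) * m ^ 3)) →
      α < β →
      Literature.ModelTheory.ExponentialFields.IsSemialgebraic ℚ {x : Fin 1 → ℝ | x 0 ∈ Ioo α β} →
      ((0 ≤ α ∧ σ = 1) ∨ (β ≤ 0 ∧ σ = -1)) →
      (∀ y ∈ Ioo α β, 0 < aeval y (G.comp (X ^ 2))) →
      IntegrableOn (fun x : Fin 1 → ℝ => 1 / Real.sqrt (aeval (x 0) (G.comp (X ^ 2))))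
        {x | x 0 ∈ Ioo α β} →
      ∃ O t : KZ.IntegralRep 1,
        O.domain = {x | x 0 ∈ Ioo α β} ∧
        O.integrand = (fun x => (a₁ : ℝ) * x 0 / Real.sqrt (aeval (x 0) (G.comp (X ^ 2)))) ∧
        t.domain = {x | x 0 ∈ (fun y : ℝ => (y ^ 2 - s) / m) '' Ioo α β} ∧
        EqOn t.integrand (fun x => ((σ * a₁ * |m| / (2 * |k|) : ℚ) : ℝ) /
          Real.sqrt (x 0 ^ 3 + (A : ℝ) * x 0 + (B : ℝ))) t.domain ∧
        KZ.of O - KZ.of t ∈ KZ.relations) ∧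
    (∀ (G : ℚ[X]) (m s k : ℚ) (A B : ℤ) (a₀ : ℚ) (α β : ℝ), m ≠ 0 → k ≠ 0 →
      (∀ y : ℝ, (m : ℝ) ^ 3 * aeval y (G.comp (X ^ 2)) =
        (k : ℝ) ^ 2 * ((1 - s * y ^ 2) ^ 3 + (A : ℝ) * m ^ 2 * y ^ 4 * (1 - s * y ^ 2) +
          (B : ℝ) * m ^ 3 * y ^ 6)) →
      α < β →
      Literature.ModelTheory.ExponentialFields.IsSemialgebraic ℚ {x : Fin 1 → ℝ | x 0 ∈ Ioo α β} →
      (0 ≤ α ∨ β ≤ 0) →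
      (∀ y ∈ Ioo α β, 0 < aeval y (G.comp (X ^ 2))) →
      IntegrableOn (fun x : Fin 1 → ℝ => 1 / Real.sqrt (aeval (x 0) (G.comp (X ^ 2))))
        {x | x 0 ∈ Ioo α β} →
      ∃ E t : KZ.IntegralRep 1,
        E.domain = {x | x 0 ∈ Ioo α β} ∧
        E.integrand = (fun x => (a₀ : ℝ) / Real.sqrt (aeval (x 0) (G.comp (X ^ 2)))) ∧
        t.domain = {x | x 0 ∈ (fun y : ℝ => ((y ^ 2)⁻¹ - s) / m) '' Ioo α β} ∧
        EqOn t.integrand (fun x => ((a₀ * |m| / (2 * |k|) : ℚ) : ℝ) /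
          Real.sqrt (x 0 ^ 3 + (A : ℝ) * x 0 + (B : ℝ))) t.domain ∧
        KZ.of E - KZ.of t ∈ KZ.relations) :=
  ⟨halfMove_odd, halfMove_even⟩

end Summit.KontsevichZagierPeriods.IsogenyCertificates.BiellipticRealPeriodCellStubs.HalfMoves

end
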